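import Mathlib.RingTheory.Length
import Mathlib.RingTheory.Ideal.Operations
import Mathlib.GroupTheory.Coset.Card
import Mathlib.GroupTheory.QuotientGroup.Basic
import HarnessLib

/-!
# A subgroup cut out inside another by one condition through a homomorphism: image, kernel,
# first isomorphism, cardinality, length, exponent (proofs file)

Topic `Algebra/Module`.  THEOREMS ONLY: no definition, no named fact, no instance, no `sorry`; Mathlib only.

For a homomorphism `f : A → B` of abelian groups (resp. an `R`-linear map `f : V → W`), a subgroup
(submodule) `S ≤ A` and a subgroup `C ≤ B`, the subgroup `G = S ∩ f⁻¹(C)` cut out inside `S` by ONE extra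
condition through `f`:

* `f(S ∩ f⁻¹(C)) = f(S) ∩ C` (`AddSubgroup.map_inf_comap_eq_map_inf`, `Submodule.map_inf_comap_eq_map_inf`);
* `S ∩ f⁻¹(C) ∩ ker f = S ∩ ker f` (`AddSubgroup.inf_comap_inf_ker`);
* the first isomorphism theorem for `f|_G`: `G / (G ∩ ker f) ≃+ f(G)`
  (`AddSubgroup.nonempty_quotient_ker_addSubgroupOf_addEquiv_map`), hence
  **`#G = #(G ∩ ker f) · #f(G)`** (`AddSubgroup.card_eq_card_inf_ker_mul_card_map`, `Nat.card`);
* **`len_R G = len_R (G ∩ ker f) + len_R f(G)`** (`Submodule.length_eq_length_inf_ker_add_length_map`,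
  `Module.length`, no finiteness needed);
* **`r • G ≤ ker f ↔ r • f(G) = 0`** (`Submodule.smul_le_ker_iff_smul_map_eq_bot`).

WHY (cell `pub/bsd-print-x9`, G87 = Howard 2004 Thm. 1.6.1, print leaf of stmt-BirchSwinnertonDyer-22642; seat
`bsd-line-x9-p1-w3` g14, brick (LOC-ID)): this is the algebra of the `loc_λ` identifications of B. Howard,
*The Heegner point Kolyvagin system*, Compositio Math. 140 (2004) §1.5 (arXiv:1202.6340 §2.5, p. 10): with
`f = loc_ℓ`, `S = 𝓗^ℓ(n)` and `C ∈ {H¹_f(K_ℓ, T), H¹_tr(K_ℓ, T)}` one gets `G ∈ {𝓗(n), 𝓗(nℓ)}`,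
`G ∩ ker f = 𝓗_ℓ(n)`, `f(G) ∈ {A_f, A_tr}` — «Localization at `ℓ` gives an isomorphism» (p. 10 L98–104),
the cokernel lengths of Lemma 1.5.8, and «`loc_ℓ(Stub(n)) = 0` implies that `𝔪^{λ(n)}` kills the lower left
quotient» (Prop. 1.5.9).  The Selmer-structure reading is
`NumberTheory/GaloisRepresentations/SelmerStructureOnePlaceComparisonProofs`.

References: [AtiyahMacdonald1969] M. F. Atiyah, I. G. Macdonald, *Introduction to Commutative Algebra* (1969),
Ch. 2 and Prop. 6.9 (additivity of length); [Howard2004HeegnerKolyvagin] B. Howard, Compositio Math. 140 (2004)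
§1.5.  BSD is not proved by any of this.
-/

set_option autoImplicit false

noncomputable section


namespace AddSubgroup

variable {A B : Type*} [AddCommGroup A] [AddCommGroup B]

/-- `f(S ∩ f⁻¹(C)) = f(S) ∩ C` for additive subgroups.
[cite: AtiyahMacdonald1969, Ch. 2 (folklore)] -/
theorem map_inf_comap_eq_map_inf (f : A →+ B) (S : AddSubgroup A) (C : AddSubgroup B) :
    (S ⊓ C.comap f).map f = S.map f ⊓ C := by
  ext y
  constructor
  · rintro ⟨x, ⟨hxS, hxC⟩, rfl⟩
    exact ⟨⟨x, hxS, rfl⟩, hxC⟩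
  · rintro ⟨⟨x, hxS, rfl⟩, hyC⟩
    exact ⟨x, ⟨hxS, hyC⟩, rfl⟩

/-- `ker f ≤ f⁻¹(C)`, so `S ∩ f⁻¹(C) ∩ ker f = S ∩ ker f`.
[cite: AtiyahMacdonald1969, Ch. 2 (folklore)] -/
theorem inf_comap_inf_ker (f : A →+ B) (S : AddSubgroup A) (C : AddSubgroup B) :
    S ⊓ C.comap f ⊓ f.ker = S ⊓ f.ker := by
  refine le_antisymm (fun x hx => ?_) (fun x hx => ?_)
  · obtain ⟨⟨hxS, -⟩, hxk⟩ := AddSubgroup.mem_inf.1 hx |>.imp_left AddSubgroup.mem_inf.1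
    exact AddSubgroup.mem_inf.2 ⟨hxS, hxk⟩
  · obtain ⟨hxS, hxk⟩ := AddSubgroup.mem_inf.1 hx
    refine AddSubgroup.mem_inf.2 ⟨AddSubgroup.mem_inf.2 ⟨hxS, ?_⟩, hxk⟩
    rw [AddSubgroup.mem_comap, (AddMonoidHom.mem_ker).1 hxk]
    exact C.zero_mem

/-- First isomorphism theorem for the restriction of `f` to a subgroup `G`: `G / (G ∩ ker f) ≃+ f(G)`
(the quotient is by `ker f` seen inside `G`).
[cite: AtiyahMacdonald1969, Ch. 2 (folklore)] -/
theorem nonempty_quotient_ker_addSubgroupOf_addEquiv_map (f : A →+ B) (G : AddSubgroup A) :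
    Nonempty (↥G ⧸ f.ker.addSubgroupOf G ≃+ ↥(G.map f)) := by
  have hker : (f.comp G.subtype).ker = f.ker.addSubgroupOf G := rfl
  have hrange : (f.comp G.subtype).range = G.map f := by
    rw [AddMonoidHom.range_comp, AddSubgroup.range_subtype]
  exact ⟨(QuotientAddGroup.quotientAddEquivOfEq hker.symm).trans
    ((QuotientAddGroup.quotientKerEquivRange (f.comp G.subtype)).trans
      (AddEquiv.addSubgroupCongr hrange))⟩

/-- **`#G = #(G ∩ ker f) · #f(G)`** for a subgroup `G` and a homomorphism `f` (Lagrange + the first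
isomorphism theorem; `Nat.card`, so `0 = 0 · _` in the infinite case).
[cite: AtiyahMacdonald1969, Prop. 6.9 (folklore counting)] -/
theorem card_eq_card_inf_ker_mul_card_map (f : A →+ B) (G : AddSubgroup A) :
    Nat.card ↥G = Nat.card ↥(G ⊓ f.ker) * Nat.card ↥(G.map f) := by
  obtain ⟨e⟩ := nonempty_quotient_ker_addSubgroupOf_addEquiv_map f G
  rw [AddSubgroup.card_eq_card_quotient_mul_card_addSubgroup (f.ker.addSubgroupOf G),
    Nat.card_congr e.toEquiv, ← AddSubgroup.inf_addSubgroupOf_left,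
    Nat.card_congr (AddSubgroup.addSubgroupOfEquivOfLe (inf_le_left : G ⊓ f.ker ≤ G)).toEquiv,
    mul_comm]

end AddSubgroup

namespace Submodule

open Pointwise

variable {R : Type*} [CommRing R] {V W : Type*} [AddCommGroup V] [Module R V] [AddCommGroup W]
  [Module R W]

/-- `f(S ∩ f⁻¹(C)) = f(S) ∩ C` for submodules (Mathlib's `map_inf_eq_map_inf_comap`, oriented).
[cite: AtiyahMacdonald1969, Ch. 2 (folklore)] -/
theorem map_inf_comap_eq_map_inf (f : V →ₗ[R] W) (S : Submodule R V) (C : Submodule R W) :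
    (S ⊓ C.comap f).map f = S.map f ⊓ C :=
  Submodule.map_inf_eq_map_inf_comap.symm

/-- **`len_R G = len_R (G ∩ ker f) + len_R f(G)`**: additivity of the length along the exact sequence
`0 → G ∩ ker f → G → f(G) → 0` (no finiteness needed: `⊤ + _ = ⊤`).
[cite: AtiyahMacdonald1969, Prop. 6.9] -/
theorem length_eq_length_inf_ker_add_length_map (f : V →ₗ[R] W) (G : Submodule R V) :
    Module.length R ↥G =
      Module.length R ↥(G ⊓ LinearMap.ker f) + Module.length R ↥(G.map f) := by
  set g : ↥G →ₗ[R] W := f.domRestrict G with hg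
  have hex : Function.Exact (LinearMap.ker g).subtype g.rangeRestrict := by
    rw [LinearMap.exact_iff, LinearMap.ker_rangeRestrict, Submodule.range_subtype]
  have h := Module.length_eq_add_of_exact (LinearMap.ker g).subtype g.rangeRestrict
    (Submodule.subtype_injective _) (LinearMap.surjective_rangeRestrict g) hex
  have hk : LinearMap.ker g = Submodule.comap G.subtype (G ⊓ LinearMap.ker f) := by
    ext x
    simp [hg, LinearMap.mem_ker]
  have hr : LinearMap.range g = G.map f := by
    rw [hg, LinearMap.range_domRestrict]
  rw [h, hk, (Submodule.comapSubtypeEquivOfLe (inf_le_left : G ⊓ LinearMap.ker f ≤ G)).length_eq,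
    (LinearEquiv.ofEq _ _ hr).length_eq]

/-- **`r • G ≤ ker f ↔ r • f(G) = 0`** («`loc(𝔪^λ 𝓗) = 0 ⟺ 𝔪^λ · loc(𝓗) = 0`»).
[cite: Howard2004HeegnerKolyvagin, Prop. 1.5.9 (proof) (arXiv:1202.6340 Prop. 2.5.9, p. 11 L3–9)] -/
theorem smul_le_ker_iff_smul_map_eq_bot (f : V →ₗ[R] W) (G : Submodule R V) (r : R) :
    r • G ≤ LinearMap.ker f ↔ r • G.map f = ⊥ := by
  rw [LinearMap.le_ker_iff_map, Submodule.map_pointwise_smul]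

end Submodule

end
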